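import Summits.QuantumFields.YangMills.Theorems.UnitScaleTiltProp8ChartHInvTent
import HarnessLib

/-!
# Route `UnitScaleTilt`, crux K1 «MinimiserStabilityRegPr» (stmt-QuantumFields-19200), leaf V2′ — the P2→P3 BRIDGE (hH of `ChartRemainderAt`),
# part B3a: **THE QUARTIC SMOOTH-TENT PROFILE AND ITS ZERO EXTENSION ALONG A LINE OF BLOCKS** (first file of WANTED №g26-1 row (X3): the (46) GRADIENT row
# of the chart-H `H X = H₀X̃′ + dφ`)

Cell `ym3-torus` (HUMAN RULING D-0037: YM ladder rung R3 — SU(2) YM₃ on the torus is a RUNG, not the Clay problem), width seat `ym-ust-19200-w3` gen 4;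
`--supports stmt-QuantumFields-19200 --as helper`; def-free, 0 sorry.

WHY.  The bridge of parts A–C (`ChartHInvBridge`, `ChartHInvLetter.exists_rightInverse`) spreads the pinned values `Λ_j(Y)(y)` of the comb functional by the
piecewise-LINEAR tents of `ChartHInvTent.exists_tent`; the sup letter (46)₁ needs only their slope `2/L^j`.  The GRADIENT row (46)₂ of [Balaban1985Variational]
(`(L^jη)²|∇^η(HX)| ≤ B₀|X|`, the `w 2·L^{K−n}` row of `FlatCubeOpsText.HSupLetterG`, consumed by `FlatProp4Dressing.hWq_of_dressing` through the size of the chart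
shift `Y − H(D Y)`) needs SECOND differences of the spreading functions of size `O(L^{−2j})`: a linear tent has a kink of size `4/(L^j+1)` at its centre plane, which in
the weight `L^{2j}η` against `‖Λ_j(Y)(y)‖ ≈ C·t/η` is `≈ L^j·t` — not k-uniform.  This file and its sequel (`…ChartHInvSmoothTent`, ★★OWNER g26 ASSIGNMENTS 9 (a): the bump of record) supply SMOOTH tents instead.

THE PROFILE.  On the labels `o = 0, …, N − 1` of a block of odd side `N = L^j = 2c + 1` the one-dimensional profile is the quartic
`g(o) = ((o+1)(N−o))² / (c+1)⁴`: `g(c) = 1`, `0 ≤ g ≤ 1` on `[−1, N]` (AM–GM), DOUBLE ZEROS at the two virtual labels `o = −1` and `o = N` just outside the block (so the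
extension by zero across a block face is flat to second order: `g(0) = g(N−1) ≤ 4/(c+1)²`, `g(1), g(N−2) ≤ 16/(c+1)²`), `|g(o+1) − g(o)| ≤ 4/(c+1)` and
`|g(o+2) − 2g(o+1) + g(o)| ≤ 32/(c+1)²` on `[−1, N]` (with `q = (o+1)(N−o)`, `a = N − 2o − 2`: `Δq = a`, `Δ²(q²) = 2a² − 8a + 4 − 4q`).

WHAT IS PROVED (theorems only; no definition): §1 the profile (`bump1_*`: AM–GM bound, centre, double zeros, symmetry, near-face smallness, first and second differences);
§2 its extension by zero along a line of blocks `G(w) = [w / N = a]·g(w mod N)` on `ℕ` (`bumpExt_*`: equals the polynomial on the window `[aN − 1, aN + N]`, values in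
`[0, 1]`, near-face and end-label smallness, `|ΔG| ≤ 4/(c+1)`, `|Δ²G| ≤ 32/(c+1)²` EVERYWHERE on `ℕ`).  Elementary real algebra; nothing of Bałaban's asserted.
NOT a claim about the stub, the crux, the rung or the mass gap.

References: T. Bałaban, CMP **102** (1985) 277–309 [Balaban1985Variational] ((46) p.285); CMP **96** (1984) 223–250 [Balaban1984PropagatorsII] ((2.2)–(2.4) p.224,
(2.147) p.248).
-/

set_option autoImplicit false

noncomputable section

open scoped BigOperators

namespace Summit.QuantumFields.YangMills.Theorems.ChartHInv

/-! ## §1 The one-dimensional quartic profile `g(t) = ((t+1)(N−t))²/(c+1)⁴`, `N = 2c+1` -/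

section Bump1

variable {N c : ℕ} (hN : N = 2 * c + 1) (g : ℝ → ℝ) (hg : ∀ t, g t = ((t + 1) * ((N : ℝ) - t)) ^ 2 / ((c : ℝ) + 1) ^ 4)

include hN in
/-- `N + 1 = 2(c+1)` over `ℝ`. [folklore] -/
theorem bump1_cast : (N : ℝ) = 2 * c + 1 := by rw [hN]; push_cast; ring

include hN in
/-- AM–GM for the two factors of the profile: `0 ≤ (t+1)(N−t) ≤ (c+1)²` for `t ∈ [−1, N]` (`(t+1) + (N−t) = 2(c+1)`). [folklore] -/
theorem bump1_q_bounds {t : ℝ} (h1 : -1 ≤ t) (h2 : t ≤ N) : 0 ≤ (t + 1) * ((N : ℝ) - t) ∧ (t + 1) * ((N : ℝ) - t) ≤ ((c : ℝ) + 1) ^ 2 := by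
  have hNc := bump1_cast hN
  refine ⟨mul_nonneg (by linarith) (by linarith), ?_⟩
  nlinarith [sq_nonneg (t + 1 - ((c : ℝ) + 1))]

include hN hg in
/-- The profile is at most `1` on `[−1, N]`. [folklore] -/
theorem bump1_le_one {t : ℝ} (h1 : -1 ≤ t) (h2 : t ≤ N) : g t ≤ 1 := by
  obtain ⟨hq0, hq⟩ := bump1_q_bounds hN h1 h2
  have hc : (0 : ℝ) < ((c : ℝ) + 1) ^ 4 := by positivity
  rw [hg, div_le_one hc, show ((c : ℝ) + 1) ^ 4 = (((c : ℝ) + 1) ^ 2) ^ 2 by ring]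
  exact pow_le_pow_left₀ hq0 hq 2

include hN hg in
/-- The profile is `1` at the centre label `c`. [folklore] -/
theorem bump1_centre : g c = 1 := by
  have hNc := bump1_cast hN
  have hc : ((c : ℝ) + 1) ^ 4 ≠ 0 := by positivity
  rw [hg, div_eq_one_iff_eq hc, hNc]
  ring

include hg in
/-- The profile vanishes at the virtual label `−1` (left of the block). [folklore] -/
theorem bump1_left : g (-1) = 0 := by rw [hg]; simp

include hg in
/-- The profile vanishes at the virtual label `N` (right of the block). [folklore] -/
theorem bump1_right : g N = 0 := by rw [hg]; simp

include hg in
/-- The profile is symmetric about the centre: `g(N − 1 − t) = g(t)`. [folklore] -/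
theorem bump1_symm (t : ℝ) : g ((N : ℝ) - 1 - t) = g t := by
  rw [hg, hg]
  congr 1
  ring

include hN hg in
/-- Near the two faces the profile is `O((c+1)⁻²)`: `g(t) ≤ 16/(c+1)²` for `t ∈ [−1, 1] ∪ [N−2, N]`. [folklore] -/
theorem bump1_near_face {t : ℝ} (h1 : -1 ≤ t) (h2 : t ≤ N) (hnear : t ≤ 1 ∨ (N : ℝ) - 2 ≤ t) : g t ≤ 16 / ((c : ℝ) + 1) ^ 2 := by
  have hNc := bump1_cast hN
  obtain ⟨hq0, -⟩ := bump1_q_bounds hN h1 h2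
  have hc1 : (0 : ℝ) < (c : ℝ) + 1 := by positivity
  have hq : (t + 1) * ((N : ℝ) - t) ≤ 4 * ((c : ℝ) + 1) := by
    rcases hnear with h | h
    · have ha : t + 1 ≤ 2 := by linarith
      have hb : (N : ℝ) - t ≤ 2 * ((c : ℝ) + 1) := by linarith
      calc (t + 1) * ((N : ℝ) - t) ≤ 2 * (2 * ((c : ℝ) + 1)) := mul_le_mul ha hb (by linarith) (by norm_num)
        _ = 4 * ((c : ℝ) + 1) := by ring
    · have ha : t + 1 ≤ 2 * ((c : ℝ) + 1) := by linarith
      have hb : (N : ℝ) - t ≤ 2 := by linarith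
      calc (t + 1) * ((N : ℝ) - t) ≤ (2 * ((c : ℝ) + 1)) * 2 := mul_le_mul ha hb (by linarith) (by positivity)
        _ = 4 * ((c : ℝ) + 1) := by ring
  have hsq : ((t + 1) * ((N : ℝ) - t)) ^ 2 ≤ (4 * ((c : ℝ) + 1)) ^ 2 := pow_le_pow_left₀ hq0 hq 2
  rw [hg, div_le_div_iff₀ (by positivity) (by positivity)]
  nlinarith [hsq, hc1]

include hN hg in
/-- At the two end labels the profile is `g(0) = g(N−1) = N²/(c+1)⁴ ≤ 4/(c+1)²`. [folklore] -/
theorem bump1_ends : g 0 ≤ 4 / ((c : ℝ) + 1) ^ 2 ∧ g ((N : ℝ) - 1) ≤ 4 / ((c : ℝ) + 1) ^ 2 := by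
  have hNc := bump1_cast hN
  have hc1 : (0 : ℝ) < (c : ℝ) + 1 := by positivity
  have h0 : g 0 ≤ 4 / ((c : ℝ) + 1) ^ 2 := by
    rw [hg, div_le_div_iff₀ (by positivity) (by positivity)]
    have : ((0 + 1) * ((N : ℝ) - 0)) ^ 2 = (2 * c + 1) ^ 2 := by rw [hNc]; ring
    rw [this]
    nlinarith [hc1, sq_nonneg ((c : ℝ) + 1)]
  refine ⟨h0, ?_⟩
  have := bump1_symm g hg 0
  rw [sub_zero] at this
  rw [this]; exact h0

include hN hg in
/-- **FIRST DIFFERENCES**: `|g(t+1) − g(t)| ≤ 4/(c+1)` for `t ∈ [−1, N−1]` (`Δq = N − 2t − 2`, `|Δq| ≤ 2(c+1)`, `0 ≤ q ≤ (c+1)²`). [folklore] -/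
theorem bump1_diff {t : ℝ} (h1 : -1 ≤ t) (h2 : t + 1 ≤ N) : |g (t + 1) - g t| ≤ 4 / ((c : ℝ) + 1) := by
  have hNc := bump1_cast hN
  have hc1 : (0 : ℝ) < (c : ℝ) + 1 := by positivity
  obtain ⟨hq0, hq⟩ := bump1_q_bounds hN h1 (by linarith)
  obtain ⟨hq0', hq'⟩ := bump1_q_bounds hN (t := t + 1) (by linarith) h2
  set q₀ : ℝ := (t + 1) * ((N : ℝ) - t) with hq₀
  set q₁ : ℝ := (t + 1 + 1) * ((N : ℝ) - (t + 1)) with hq₁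
  have ha : |q₁ - q₀| ≤ 2 * ((c : ℝ) + 1) := by
    have : q₁ - q₀ = (N : ℝ) - 2 * t - 2 := by rw [hq₁, hq₀]; ring
    rw [this, abs_le]; constructor <;> linarith
  have hdiff : |q₁ ^ 2 - q₀ ^ 2| ≤ 4 * ((c : ℝ) + 1) ^ 3 := by
    rw [sq_sub_sq, abs_mul]
    have hsum : |q₁ + q₀| ≤ 2 * ((c : ℝ) + 1) ^ 2 := by rw [abs_of_nonneg (by linarith)]; linarith
    calc |q₁ + q₀| * |q₁ - q₀| ≤ (2 * ((c : ℝ) + 1) ^ 2) * (2 * ((c : ℝ) + 1)) := mul_le_mul hsum ha (abs_nonneg _) (by positivity)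
      _ = 4 * ((c : ℝ) + 1) ^ 3 := by ring
  rw [hg, hg, ← sub_div, abs_div, abs_of_pos (by positivity : (0 : ℝ) < ((c : ℝ) + 1) ^ 4), div_le_div_iff₀ (by positivity) hc1]
  calc |q₁ ^ 2 - q₀ ^ 2| * ((c : ℝ) + 1) ≤ 4 * ((c : ℝ) + 1) ^ 3 * ((c : ℝ) + 1) := mul_le_mul_of_nonneg_right hdiff hc1.le
    _ = 4 * ((c : ℝ) + 1) ^ 4 := by ring

include hN hg in
/-- **SECOND DIFFERENCES**: `|g(t+2) − 2g(t+1) + g(t)| ≤ 32/(c+1)²` for `t ∈ [−1, N−2]` (`Δ²(q²) = 2a² − 8a + 4 − 4q`, `a = N − 2t − 2`). [folklore] -/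
theorem bump1_diff2 {t : ℝ} (h1 : -1 ≤ t) (h2 : t + 2 ≤ N) : |g (t + 2) - 2 * g (t + 1) + g t| ≤ 32 / ((c : ℝ) + 1) ^ 2 := by
  have hNc := bump1_cast hN
  have hc1 : (1 : ℝ) ≤ (c : ℝ) + 1 := by have : (0 : ℝ) ≤ c := Nat.cast_nonneg c; linarith
  have hc0 : (0 : ℝ) < (c : ℝ) + 1 := by positivity
  obtain ⟨hq0, hq⟩ := bump1_q_bounds hN h1 (by linarith)
  set q₀ : ℝ := (t + 1) * ((N : ℝ) - t) with hq₀
  set a : ℝ := (N : ℝ) - 2 * t - 2 with ha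
  have ha1 : a ≤ 2 * ((c : ℝ) + 1) := by rw [ha]; linarith
  have ha2 : -(2 * ((c : ℝ) + 1)) ≤ a := by rw [ha]; linarith
  have hkey : ((t + 2 + 1) * ((N : ℝ) - (t + 2))) ^ 2 - 2 * ((t + 1 + 1) * ((N : ℝ) - (t + 1))) ^ 2 + q₀ ^ 2 =
      2 * a ^ 2 - 8 * a + 4 - 4 * q₀ := by rw [hq₀, ha]; ring
  have hbound : |2 * a ^ 2 - 8 * a + 4 - 4 * q₀| ≤ 32 * ((c : ℝ) + 1) ^ 2 := by
    rw [abs_le]; constructor <;> nlinarith [ha1, ha2, hq0, hq, hc1]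
  have hexp : g (t + 2) - 2 * g (t + 1) + g t =
      (((t + 2 + 1) * ((N : ℝ) - (t + 2))) ^ 2 - 2 * ((t + 1 + 1) * ((N : ℝ) - (t + 1))) ^ 2 + q₀ ^ 2) / ((c : ℝ) + 1) ^ 4 := by
    rw [hg, hg, hg, hq₀]; ring
  rw [hexp, hkey, abs_div, abs_of_pos (by positivity : (0 : ℝ) < ((c : ℝ) + 1) ^ 4), div_le_div_iff₀ (by positivity) (by positivity)]
  calc |2 * a ^ 2 - 8 * a + 4 - 4 * q₀| * ((c : ℝ) + 1) ^ 2 ≤ 32 * ((c : ℝ) + 1) ^ 2 * ((c : ℝ) + 1) ^ 2 :=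
        mul_le_mul_of_nonneg_right hbound (by positivity)
    _ = 32 * ((c : ℝ) + 1) ^ 4 := by ring

end Bump1

/-! ## §2 The zero extension along a line of blocks: `G(w) = [w / N = a]·g(w mod N)` on `ℕ` -/

section Ext

/-- `w / N = a` iff `w` is a label of the block `a`: `aN ≤ w < aN + N`. [folklore] -/
theorem nat_div_eq_iff {N : ℕ} (hN : 0 < N) (w a : ℕ) : w / N = a ↔ a * N ≤ w ∧ w < a * N + N := by
  constructor
  · intro h
    have h1 : a ≤ w / N := h ▸ le_rfl
    have h2 : w / N < a + 1 := h ▸ Nat.lt_succ_self a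
    refine ⟨(Nat.le_div_iff_mul_le hN).1 h1, ?_⟩
    have := (Nat.div_lt_iff_lt_mul hN).1 h2
    rwa [add_one_mul] at this
  · rintro ⟨h1, h2⟩
    refine le_antisymm (Nat.lt_succ_iff.1 ((Nat.div_lt_iff_lt_mul hN).2 ?_)) ((Nat.le_div_iff_mul_le hN).2 h1)
    rw [Nat.succ_mul]; exact h2

variable {N c : ℕ} (hN : N = 2 * c + 1) (g : ℝ → ℝ) (hg : ∀ t, g t = ((t + 1) * ((N : ℝ) - t)) ^ 2 / ((c : ℝ) + 1) ^ 4)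
  (a : ℕ) (G : ℕ → ℝ) (hG : ∀ w, G w = if w / N = a then g ((w % N : ℕ) : ℝ) else 0)

include hG in
/-- Off the block `a` the extension vanishes. [folklore] -/
theorem bumpExt_zero {w : ℕ} (hw : w / N ≠ a) : G w = 0 := by rw [hG, if_neg hw]

include hN hg hG in
/-- **THE EXTENSION IS THE POLYNOMIAL ON THE WINDOW `[aN − 1, aN + N]`** (double zeros at the two virtual labels): for `aN ≤ w + 1` and `w ≤ aN + N`,
`G(w) = g(w − aN)`. [folklore] -/
theorem bumpExt_eq_poly {w : ℕ} (hw1 : a * N ≤ w + 1) (hw2 : w ≤ a * N + N) : G w = g ((w : ℝ) - a * N) := by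
  have hNpos : 0 < N := by omega
  by_cases h : w / N = a
  · -- inside the block: `w = aN + (w mod N)`
    have hdm := Nat.div_add_mod w N
    rw [h] at hdm
    have hcast : (((w % N : ℕ)) : ℝ) = (w : ℝ) - a * N := by
      have : ((N * a + w % N : ℕ) : ℝ) = (w : ℝ) := by rw [hdm]
      push_cast at this
      linarith
    rw [hG, if_pos h, hcast]
  · -- the two virtual labels `w + 1 = aN` and `w = aN + N`
    rw [hG, if_neg h]
    have hcases : w + 1 = a * N ∨ w = a * N + N := by
      have hnot : ¬(a * N ≤ w ∧ w < a * N + N) := fun hh => h ((nat_div_eq_iff hNpos w a).2 hh)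
      omega
    rcases hcases with h1 | h2
    · have : (w : ℝ) - a * N = -1 := by
        have : ((w + 1 : ℕ) : ℝ) = ((a * N : ℕ) : ℝ) := by rw [h1]
        push_cast at this; linarith
      rw [this, bump1_left g hg]
    · have : (w : ℝ) - a * N = N := by rw [h2]; push_cast; ring
      rw [this, bump1_right g hg]

include hN hg hG in
/-- The extension takes values in `[0, 1]`. [folklore] -/
theorem bumpExt_mem_unit (w : ℕ) : 0 ≤ G w ∧ G w ≤ 1 := by
  have hNpos : 0 < N := by omega
  rw [hG]
  split_ifs with h
  · have hlt : w % N < N := Nat.mod_lt _ hNpos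
    have h1 : (-1 : ℝ) ≤ ((w % N : ℕ) : ℝ) := by have : (0 : ℝ) ≤ ((w % N : ℕ) : ℝ) := Nat.cast_nonneg _; linarith
    have h2 : ((w % N : ℕ) : ℝ) ≤ N := by exact_mod_cast hlt.le
    exact ⟨by rw [hg]; positivity, bump1_le_one hN g hg h1 h2⟩
  · exact ⟨le_rfl, zero_le_one⟩

include hN hg hG in
/-- Near a face (labels `0, 1, N−2, N−1`) the extension is `≤ 16/(c+1)²`. [folklore] -/
theorem bumpExt_near_face {w : ℕ} (hw : w % N ≤ 1 ∨ N - 2 ≤ w % N) : G w ≤ 16 / ((c : ℝ) + 1) ^ 2 := by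
  have hNpos : 0 < N := by omega
  rw [hG]
  split_ifs with h
  · have hlt : w % N < N := Nat.mod_lt _ hNpos
    have h1 : (-1 : ℝ) ≤ ((w % N : ℕ) : ℝ) := by have : (0 : ℝ) ≤ ((w % N : ℕ) : ℝ) := Nat.cast_nonneg _; linarith
    have h2 : ((w % N : ℕ) : ℝ) ≤ N := by exact_mod_cast hlt.le
    refine bump1_near_face hN g hg h1 h2 ?_
    rcases hw with hw | hw
    · left; exact_mod_cast hw
    · right
      have : ((N - 2 : ℕ) : ℝ) ≤ ((w % N : ℕ) : ℝ) := by exact_mod_cast hw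
      refine le_trans ?_ this
      rcases Nat.lt_or_ge N 2 with hN2 | hN2
      · have : ((N - 2 : ℕ) : ℝ) = 0 := by rw [Nat.sub_eq_zero_of_le hN2.le]; simp
        rw [this]
        have : (N : ℝ) < 2 := by exact_mod_cast hN2
        linarith
      · rw [Nat.cast_sub hN2]; push_cast; exact le_rfl
  · positivity

include hN hg hG in
/-- At the two end labels `0` and `N − 1` the extension is `≤ 4/(c+1)²`. [folklore] -/
theorem bumpExt_ends {w : ℕ} (hw : w % N = 0 ∨ w % N = N - 1) : G w ≤ 4 / ((c : ℝ) + 1) ^ 2 := by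
  have hNpos : 0 < N := by omega
  rw [hG]
  split_ifs with h
  · rcases hw with hw | hw
    · rw [hw, Nat.cast_zero]; exact (bump1_ends hN g hg).1
    · rw [hw, Nat.cast_sub (by omega : 1 ≤ N), Nat.cast_one]; exact (bump1_ends hN g hg).2
  · positivity

include hN hg hG in
/-- **FIRST DIFFERENCES OF THE EXTENSION**: `|G(w+1) − G(w)| ≤ 4/(c+1)` for every `w` (inside the window by the polynomial; outside both values vanish).
[folklore] -/
theorem bumpExt_diff (w : ℕ) : |G (w + 1) - G w| ≤ 4 / ((c : ℝ) + 1) := by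
  have hNpos : 0 < N := by omega
  have hc0 : (0 : ℝ) ≤ 4 / ((c : ℝ) + 1) := by positivity
  by_cases hwin : a * N ≤ w + 1 ∧ w + 1 ≤ a * N + N
  · rw [bumpExt_eq_poly hN g hg a G hG (w := w) hwin.1 (by omega), bumpExt_eq_poly hN g hg a G hG (w := w + 1) (by omega) hwin.2]
    have h1 : (-1 : ℝ) ≤ (w : ℝ) - a * N := by
      have : ((a * N : ℕ) : ℝ) ≤ ((w + 1 : ℕ) : ℝ) := by exact_mod_cast hwin.1
      push_cast at this; linarith
    have h2 : (w : ℝ) - a * N + 1 ≤ N := by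
      have : ((w + 1 : ℕ) : ℝ) ≤ ((a * N + N : ℕ) : ℝ) := by exact_mod_cast hwin.2
      push_cast at this; linarith
    have := bump1_diff hN g hg h1 h2
    push_cast
    rwa [show (w : ℝ) + 1 - a * N = (w : ℝ) - a * N + 1 by ring]
  · -- both outside the block
    have hw0 : w / N ≠ a := fun h => by have := (nat_div_eq_iff hNpos w a).1 h; omega
    have hw1 : (w + 1) / N ≠ a := fun h => by have := (nat_div_eq_iff hNpos (w + 1) a).1 h; omega
    rw [bumpExt_zero g a G hG hw0, bumpExt_zero g a G hG hw1, sub_zero, abs_zero]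
    exact hc0

include hN hg hG in
/-- **SECOND DIFFERENCES OF THE EXTENSION**: `|G(w+2) − 2G(w+1) + G(w)| ≤ 32/(c+1)²` for every `w` (inside the window by the polynomial; at the window's
ends the only surviving value is an end label, `≤ 4/(c+1)²`; outside everything vanishes). [folklore] -/
theorem bumpExt_diff2 (w : ℕ) : |G (w + 2) - 2 * G (w + 1) + G w| ≤ 32 / ((c : ℝ) + 1) ^ 2 := by
  have hNpos : 0 < N := by omega
  have hc0 : (0 : ℝ) ≤ 32 / ((c : ℝ) + 1) ^ 2 := by positivity
  have h432 : 4 / ((c : ℝ) + 1) ^ 2 ≤ 32 / ((c : ℝ) + 1) ^ 2 := div_le_div_of_nonneg_right (by norm_num) (by positivity)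
  by_cases hwin : a * N ≤ w + 1 ∧ w + 2 ≤ a * N + N
  · rw [bumpExt_eq_poly hN g hg a G hG (w := w) hwin.1 (by omega), bumpExt_eq_poly hN g hg a G hG (w := w + 1) (by omega) (by omega),
      bumpExt_eq_poly hN g hg a G hG (w := w + 2) (by omega) hwin.2]
    have h1 : (-1 : ℝ) ≤ (w : ℝ) - a * N := by
      have : ((a * N : ℕ) : ℝ) ≤ ((w + 1 : ℕ) : ℝ) := by exact_mod_cast hwin.1
      push_cast at this; linarith
    have h2 : (w : ℝ) - a * N + 2 ≤ N := by
      have : ((w + 2 : ℕ) : ℝ) ≤ ((a * N + N : ℕ) : ℝ) := by exact_mod_cast hwin.2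
      push_cast at this; linarith
    have := bump1_diff2 hN g hg h1 h2
    push_cast
    rwa [show (w : ℝ) + 2 - a * N = (w : ℝ) - a * N + 2 by ring, show (w : ℝ) + 1 - a * N = (w : ℝ) - a * N + 1 by ring]
  · rcases Nat.lt_or_ge (w + 1) (a * N) with hlt | hge
    · -- left of the window: `G w = G (w+1) = 0`, `G (w+2) ∈ {0, g 0}`
      have hw0 : w / N ≠ a := fun h => by have := (nat_div_eq_iff hNpos w a).1 h; omega
      have hw1 : (w + 1) / N ≠ a := fun h => by have := (nat_div_eq_iff hNpos (w + 1) a).1 h; omega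
      rw [bumpExt_zero g a G hG hw0, bumpExt_zero g a G hG hw1, mul_zero, sub_zero, add_zero]
      rcases Nat.lt_or_ge (w + 2) (a * N) with hlt2 | hge2
      · have hw2 : (w + 2) / N ≠ a := fun h => by have := (nat_div_eq_iff hNpos (w + 2) a).1 h; omega
        rw [bumpExt_zero g a G hG hw2, abs_zero]; exact hc0
      · have heq : w + 2 = a * N := by omega
        have hmod : (w + 2) % N = 0 := by rw [heq, Nat.mul_mod_left]
        rw [abs_of_nonneg (bumpExt_mem_unit hN g hg a G hG _).1]
        exact (bumpExt_ends hN g hg a G hG (Or.inl hmod)).trans h432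
    · -- right of the window: `G (w+1) = G (w+2) = 0`, `G w ∈ {0, g (N−1)}`
      have hw2' : a * N + N < w + 2 := by omega
      have hw1 : (w + 1) / N ≠ a := fun h => by have := (nat_div_eq_iff hNpos (w + 1) a).1 h; omega
      have hw2 : (w + 2) / N ≠ a := fun h => by have := (nat_div_eq_iff hNpos (w + 2) a).1 h; omega
      rw [bumpExt_zero g a G hG hw1, bumpExt_zero g a G hG hw2, mul_zero, sub_zero, zero_add]
      rcases Nat.lt_or_ge w (a * N + N) with hlt3 | hge3
      · have heq : w = a * N + (N - 1) := by omega
        have hmod : w % N = N - 1 := by rw [heq, Nat.mul_comm, Nat.mul_add_mod, Nat.mod_eq_of_lt (by omega)]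
        rw [abs_of_nonneg (bumpExt_mem_unit hN g hg a G hG _).1]
        exact (bumpExt_ends hN g hg a G hG (Or.inr hmod)).trans h432
      · have hw0 : w / N ≠ a := fun h => by have := (nat_div_eq_iff hNpos w a).1 h; omega
        rw [bumpExt_zero g a G hG hw0, abs_zero]; exact hc0

end Ext

end Summit.QuantumFields.YangMills.Theorems.ChartHInv

end
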